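import Summits.ResolutionOfSingularities.ResolutionOfSingularities.Theorems.HilbertSamuelEliminationSigmaMaxModificationsCorridor3CPFrameLegality
import Summits.ResolutionOfSingularities.ResolutionOfSingularities.Theorems.FrobeniusClosingSteerCore4SteeredRegular
import Literature.AlgebraicGeometry.Resolution.BaseTreeFiniteKonig
import Literature.AlgebraicGeometry.Resolution.PermissibleCentres
import Literature.AlgebraicGeometry.Resolution.HypersurfaceMaxOrderTransform
import Literature.AlgebraicGeometry.Resolution.QuadraticTransformAlongPrime
import Literature.AlgebraicGeometry.Resolution.BlowupStalkCharts
import Literature.AlgebraicGeometry.Resolution.StalkIdealGenerization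
import Literature.RingTheory.HilbertSamuel.NormalFlatnessLocalization
import Literature.AlgebraicGeometry.Resolution.StalkSpecializesLocalization
import Literature.AlgebraicGeometry.Resolution.KollarMaxContactChartsFieldChange
import Summits.ResolutionOfSingularities.ResolutionOfSingularities.Theorems.TameCutStage
import Summits.ResolutionOfSingularities.ResolutionOfSingularities.Theorems.SurfacePort
import Summits.ResolutionOfSingularities.ResolutionOfSingularities.Theorems.TightDefectClasses
import Literature.AlgebraicGeometry.Resolution.ExcellentRingsEssFiniteType
import Literature.AlgebraicGeometry.Resolution.ExcellentRingsFieldProofs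
import Literature.AlgebraicGeometry.Resolution.ExcellentClosedSubschemes
import Literature.AlgebraicGeometry.Resolution.ArithmeticalThreefoldsLocalInField
import Literature.RingTheory.KrullDimension.AffineCatenary
import Summits.ResolutionOfSingularities.ResolutionOfSingularities.Theorems.HilbertSamuelEliminationSigmaMaxModificationsCorridor3WLadderIsoKernelCPFrame
import HarnessLib

/-!
# ShallowPort1 — kernels of the in-field stalk chain for the port `TightDefectClasses.ShallowColumnPort` (§1–§4)

* §1 `mem_span_singleton_of_pow_mul_eq` — cancellation against a prime element.
* §2 `algebraMap_mem_pow_of_isNormallyFlat` — Bennett's equimultiplicity, frame-free (CJS Thm. 2.3 / 3.3 via `hypersurfaceHFe`,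
  `hypersurfaceHFe_injective2`): a normally flat regular centre `P` of a hypersurface `A/(g)`, `g ∈ 𝔪^m`, has `g ∈ 𝔓^{(m)}`.
* §3 `PointBlowupCert` (data) / `isLocalBlowupAlong_of_cert` — a valuation-free certificate that `B' ⊆ K` is the blowing up of the
  closed point of `B ⊆ K` in the chart of a generator, read as `IsLocalBlowupAlong O B 𝔪_B B'` for ANY valuation ring `O`
  dominating `B'` (Novacoski–Spivakovsky Def. 2.11).
* §4 images of local rings in a field (`isLocalRing_range`, `subringDominates_range`, …).

References: CJS LNM 2270 Def. 3.1, Thm. 2.3, 3.3 [CossartJannsenSaito2020]; CP 2019 §2.2 [CossartPiltant2019]; Matsumura Thm. 14.2.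
AI-written; weaker than expert review.
(decomp-res lens-5 g38, critic ROW 232 (M-Shallow); host route `MaxContactCut`, item stmt-ResolutionOfSingularities-31768 `PolyPureTowersShallow`;
source of truth: the farm-checked monolith `ShallowPortNode.lean`, of which this is land slice 1/6 — slices land sequentially, slice k imports slice k-1.)
-/

noncomputable section

set_option linter.dupNamespace false

open IsLocalRing IsLocalization
open Literature.RingTheory.HilbertSamuel Literature.AlgebraicGeometry.Resolution
open Summit.ResolutionOfSingularities.ResolutionOfSingularities.Theorems.SigmaMaxModificationsCorridor3.Helpers
open Summit.ResolutionOfSingularities.ResolutionOfSingularities.Theorems.SwitchingDichotomy.SteeredRun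

universe u

namespace Summit.ResolutionOfSingularities.ResolutionOfSingularities.Theorems.ShallowPort

/-! ## §1 Cancellation against a prime element -/

section Cancel

variable {S : Type u} [CommRing S] [IsDomain S]

/-- In a domain, `e^c · x = g · t` with `e ≠ 0`, `(e)` prime and `g ∉ (e)` gives `x ∈ (g)` (peel one `e` off `t` at a time).
[folklore] -/
theorem mem_span_singleton_of_pow_mul_eq_mul {e g : S} (he0 : e ≠ 0) (he : (Ideal.span {e}).IsPrime)
    (hg : g ∉ Ideal.span {e}) : ∀ (c : ℕ) {x t : S}, e ^ c * x = g * t → x ∈ Ideal.span {g} := by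
  intro c
  induction c with
  | zero =>
    intro x t h
    rw [pow_zero, one_mul] at h
    exact h ▸ Ideal.mem_span_singleton'.mpr ⟨t, by ring⟩
  | succ c ih =>
    intro x t h
    -- `g t ∈ (e)`, so `t = t₁ e`
    have hgt : g * t ∈ Ideal.span {e} := by
      rw [← h, pow_succ]
      exact Ideal.mem_span_singleton'.mpr ⟨e ^ c * x, by ring⟩
    rcases he.mem_or_mem hgt with hge | hte
    · exact absurd hge hg
    · obtain ⟨t₁, rfl⟩ := Ideal.mem_span_singleton'.mp hte
      have h2 : e * (e ^ c * x) = e * (g * t₁) := by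
        calc e * (e ^ c * x) = e ^ (c + 1) * x := by ring
          _ = g * (t₁ * e) := h
          _ = e * (g * t₁) := by ring
      exact ih (mul_left_cancel₀ he0 h2)

/-- **Cancellation against a prime element**: in a domain, `e^a · x = e^b · g · t` with `e ≠ 0`, `(e)` prime and
`g ∉ (e)` forces `x ∈ (g)` — whatever the exponents. (Used twice along the stalk chain: the exceptional parameter `e`
of a point blow-up never divides the strict factor `g` of the transformed hypersurface.) [folklore] -/
theorem mem_span_singleton_of_pow_mul_eq {e g : S} (he0 : e ≠ 0) (he : (Ideal.span {e}).IsPrime)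
    (hg : g ∉ Ideal.span {e}) {a b : ℕ} {x t : S} (h : e ^ a * x = e ^ b * g * t) : x ∈ Ideal.span {g} := by
  rcases le_or_gt a b with hab | hab
  · -- cancel `e^a`: `x = e^{b-a} g t`
    obtain ⟨d, rfl⟩ := Nat.exists_eq_add_of_le hab
    have h2 : e ^ a * x = e ^ a * (e ^ d * g * t) := by rw [h]; ring
    have hx : x = e ^ d * g * t := mul_left_cancel₀ (pow_ne_zero a he0) h2
    exact hx ▸ Ideal.mem_span_singleton'.mpr ⟨e ^ d * t, by ring⟩
  · -- cancel `e^b`: `e^{a-b} x = g t`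
    obtain ⟨d, rfl⟩ := Nat.exists_eq_add_of_lt hab
    have h2 : e ^ b * (e ^ (d + 1) * x) = e ^ b * (g * t) := by
      calc e ^ b * (e ^ (d + 1) * x) = e ^ (b + d + 1) * x := by ring
        _ = e ^ b * g * t := h
        _ = e ^ b * (g * t) := by ring
    exact mem_span_singleton_of_pow_mul_eq_mul he0 he hg (d + 1) (mul_left_cancel₀ (pow_ne_zero b he0) h2)

end Cancel

/-! ## §2 Bennett's equimultiplicity for a normally flat regular centre on a hypersurface germ (frame-free) -/

section Bennett

variable {A : Type u} [CommRing A] [IsRegularLocalRing A]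

/-- A regular local ring containing a non-zero non-unit has dimension `≥ 1`. [folklore] -/
theorem ringKrullDim_pos_of_ne_zero_of_mem_maximalIdeal {S : Type u} [CommRing S] [IsRegularLocalRing S] {g : S}
    (hg0 : g ≠ 0) (hg : g ∈ maximalIdeal S) {e : ℕ} (he : ringKrullDim S = e) : 0 < e := by
  rw [Nat.pos_iff_ne_zero]
  intro h0
  have hd : (maximalIdeal S).spanFinrank = 0 := by
    have h := IsRegularLocalRing.spanFinrank_maximalIdeal (R := S)
    rw [he] at h
    have h' : (maximalIdeal S).spanFinrank = e := by exact_mod_cast h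
    omega
  have hbot : maximalIdeal S = ⊥ :=
    (Submodule.spanFinrank_eq_zero_iff_eq_bot (IsNoetherian.noetherian (maximalIdeal S))).mp hd
  rw [hbot, Ideal.mem_bot] at hg
  exact hg0 hg

/-- **Bennett / CJS Thm. 3.3 on a hypersurface germ, frame-free.**  `A` regular local, `0 ≠ g ∈ 𝔪_A^m`, `B = A/(g)`, `P` a
prime of `B` such that `B/P` is a regular local ring and `B` is NORMALLY FLAT along `P` (`Ideal.IsNormallyFlat`, CJS Def. 3.1
(1)).  Then `g` keeps order `≥ m` at the preimage `𝔓` of `P`: `g ∈ 𝔪_{A_𝔓}^m`.  Proof: `H⁽⁰⁾(B) = H⁽ʳ⁾(B_P)`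
(`hilbertFun_eq_hilbertSamuelFun_of_isNormallyFlat`), `H⁽⁰⁾(B) = hypersurfaceHFe (dim A) (ord_𝔪 g)`,
`H⁽⁰⁾(B_P) = hypersurfaceHFe (dim A_𝔓) (ord_𝔓 g)` (`B_P ≅ A_𝔓/(g)`, Serre `isRegularLocalRing_localization_atPrime`), and the
hypersurface functions determine the multiplicity (`hypersurfaceHFe_injective2`).
[cite: CossartJannsenSaito2020, Def. 3.1, Thm. 2.3, Thm. 3.3] [cite: CossartPiltant2019, Def. 2.3] -/
theorem algebraMap_mem_pow_of_isNormallyFlat {g : A} (hg0 : g ≠ 0) {m : ℕ} (hgm : g ∈ maximalIdeal A ^ m)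
    (P : Ideal (A ⧸ Ideal.span {g})) [P.IsPrime] [IsRegularLocalRing ((A ⧸ Ideal.span {g}) ⧸ P)]
    (hNF : P.IsNormallyFlat) :
    algebraMap A (Localization.AtPrime (P.comap (Ideal.Quotient.mk (Ideal.span {g})))) g ∈
      maximalIdeal (Localization.AtPrime (P.comap (Ideal.Quotient.mk (Ideal.span {g})))) ^ m := by
  rcases Nat.eq_zero_or_pos m with rfl | hm
  · rw [pow_zero, Ideal.one_eq_top]; exact Submodule.mem_top
  have hg𝔪 : g ∈ maximalIdeal A := Ideal.pow_le_self hm.ne' hgm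
  have hItop : Ideal.span {g} ≠ (⊤ : Ideal A) := by
    rw [Ne, Ideal.span_singleton_eq_top]
    exact (IsLocalRing.mem_maximalIdeal _).mp hg𝔪
  haveI : Nontrivial (A ⧸ Ideal.span {g}) := Ideal.Quotient.nontrivial_iff.mpr hItop
  haveI : IsLocalRing (A ⧸ Ideal.span {g}) :=
    IsLocalRing.of_surjective' (Ideal.Quotient.mk (Ideal.span {g})) Ideal.Quotient.mk_surjective
  haveI : (P.comap (Ideal.Quotient.mk (Ideal.span {g}))).IsPrime := Ideal.comap_isPrime _ _
  haveI hregS : IsRegularLocalRing (Localization.AtPrime (P.comap (Ideal.Quotient.mk (Ideal.span {g})))) :=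
    isRegularLocalRing_localization_atPrime A _
  haveI : IsDomain A := isDomain_of_isRegularLocalRing A
  -- the order `μ₁ ≥ m` of `g` in `A`
  obtain ⟨μ₁, hμ₁, hμ₁'⟩ := exists_mem_pow_not_mem_pow_succ (A := A) hg0
  have hmμ₁ : m ≤ μ₁ := by
    by_contra hlt
    exact hμ₁' (Ideal.pow_le_pow_right (by omega) hgm)
  -- `g` in `S = A_𝔓`: non-zero, non-unit, of some order `μ₂ ≥ 1`
  have hinj : Function.Injective
      (algebraMap A (Localization.AtPrime (P.comap (Ideal.Quotient.mk (Ideal.span {g}))))) :=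
    IsLocalization.injective _ (P.comap (Ideal.Quotient.mk (Ideal.span {g}))).primeCompl_le_nonZeroDivisors
  have hgS0 : algebraMap A (Localization.AtPrime (P.comap (Ideal.Quotient.mk (Ideal.span {g})))) g ≠ 0 :=
    fun h0 => hg0 (hinj (by rw [h0, map_zero]))
  have hg𝔓 : g ∈ P.comap (Ideal.Quotient.mk (Ideal.span {g})) := by
    rw [Ideal.mem_comap, Ideal.Quotient.eq_zero_iff_mem.mpr (Ideal.mem_span_singleton_self g)]
    exact P.zero_mem
  have hgS𝔪 : algebraMap A (Localization.AtPrime (P.comap (Ideal.Quotient.mk (Ideal.span {g})))) g ∈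
      maximalIdeal (Localization.AtPrime (P.comap (Ideal.Quotient.mk (Ideal.span {g})))) := by
    rw [← Localization.AtPrime.map_eq_maximalIdeal]
    exact Ideal.mem_map_of_mem _ hg𝔓
  obtain ⟨μ₂, hμ₂, hμ₂'⟩ := exists_mem_pow_not_mem_pow_succ hgS0
  have hμ₂1 : 1 ≤ μ₂ := by
    by_contra hlt
    have h0 : μ₂ = 0 := by omega
    rw [h0, zero_add, pow_one] at hμ₂'
    exact hμ₂' hgS𝔪
  -- dimensions `e₁, e₂ ≥ 1`
  obtain ⟨e₁, he₁⟩ : ∃ e : ℕ, ringKrullDim A = e :=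
    exists_nat_eq_of_ne_bot_of_ne_top ringKrullDim_ne_bot ringKrullDim_ne_top
  obtain ⟨e₂, he₂⟩ : ∃ e : ℕ, ringKrullDim (Localization.AtPrime (P.comap (Ideal.Quotient.mk (Ideal.span {g})))) = e :=
    exists_nat_eq_of_ne_bot_of_ne_top ringKrullDim_ne_bot ringKrullDim_ne_top
  have he₁1 : 1 ≤ e₁ := ringKrullDim_pos_of_ne_zero_of_mem_maximalIdeal hg0 hg𝔪 he₁
  have he₂1 : 1 ≤ e₂ := ringKrullDim_pos_of_ne_zero_of_mem_maximalIdeal hgS0 hgS𝔪 he₂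
  obtain ⟨t, rfl⟩ : ∃ t, e₂ = t + 1 := ⟨e₂ - 1, by omega⟩
  -- the hypersurface quotient `S/(g)` is local
  have hIS : Ideal.span {algebraMap A (Localization.AtPrime (P.comap (Ideal.Quotient.mk (Ideal.span {g})))) g} ≠ ⊤ := by
    rw [Ne, Ideal.span_singleton_eq_top]
    exact (IsLocalRing.mem_maximalIdeal _).mp hgS𝔪
  haveI : Nontrivial (Localization.AtPrime (P.comap (Ideal.Quotient.mk (Ideal.span {g}))) ⧸
      Ideal.span {algebraMap A (Localization.AtPrime (P.comap (Ideal.Quotient.mk (Ideal.span {g})))) g}) :=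
    Ideal.Quotient.nontrivial_iff.mpr hIS
  haveI : IsLocalRing (Localization.AtPrime (P.comap (Ideal.Quotient.mk (Ideal.span {g}))) ⧸
      Ideal.span {algebraMap A (Localization.AtPrime (P.comap (Ideal.Quotient.mk (Ideal.span {g})))) g}) :=
    IsLocalRing.of_surjective' (Ideal.Quotient.mk _) Ideal.Quotient.mk_surjective
  -- the two hypersurface readings
  have h1 : hilbertFun (A ⧸ Ideal.span {g}) = hypersurfaceHFe e₁ μ₁ :=
    stub_H1_hilbertFun_quotient_span_singleton he₁ hμ₁ hμ₁'
  have h2 : hilbertFun (Localization.AtPrime (P.comap (Ideal.Quotient.mk (Ideal.span {g}))) ⧸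
      Ideal.span {algebraMap A (Localization.AtPrime (P.comap (Ideal.Quotient.mk (Ideal.span {g})))) g}) =
        hypersurfaceHFe (t + 1) μ₂ :=
    stub_H1_hilbertFun_quotient_span_singleton he₂ hμ₂ hμ₂'
  -- Bennett: `H⁽⁰⁾(B) = H⁽ʳ⁾(B_P)`
  obtain ⟨r, hr⟩ : ∃ r : ℕ, ringKrullDim ((A ⧸ Ideal.span {g}) ⧸ P) = r :=
    exists_nat_eq_of_ne_bot_of_ne_top ringKrullDim_ne_bot ringKrullDim_ne_top
  haveI : IsNoetherianRing (A ⧸ Ideal.span {g}) := inferInstance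
  have hB : hilbertFun (A ⧸ Ideal.span {g}) = hilbertSamuelFun (Localization.AtPrime P) r :=
    hilbertFun_eq_hilbertSamuelFun_of_isNormallyFlat P (Localization.AtPrime P) hr hNF
  -- `B_P ≅ S/(g)`
  obtain ⟨e, -⟩ := exists_ringEquiv_localization_quotient (Ideal.span {g}) P
  have hspan : (Ideal.span {g}).map (algebraMap A (Localization.AtPrime (P.comap (Ideal.Quotient.mk (Ideal.span {g}))))) =
      Ideal.span {algebraMap A (Localization.AtPrime (P.comap (Ideal.Quotient.mk (Ideal.span {g})))) g} := by
    rw [Ideal.map_span, Set.image_singleton]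
  let e' : Localization.AtPrime P ≃+* Localization.AtPrime (P.comap (Ideal.Quotient.mk (Ideal.span {g}))) ⧸
      Ideal.span {algebraMap A (Localization.AtPrime (P.comap (Ideal.Quotient.mk (Ideal.span {g})))) g} :=
    e.trans (Ideal.quotEquivOfEq hspan)
  haveI : IsNoetherianRing (Localization.AtPrime P) :=
    IsLocalization.isNoetherianRing P.primeCompl _ inferInstance
  have hH₂ : hilbertFun (Localization.AtPrime P) =
      hilbertFun (Localization.AtPrime (P.comap (Ideal.Quotient.mk (Ideal.span {g}))) ⧸
        Ideal.span {algebraMap A (Localization.AtPrime (P.comap (Ideal.Quotient.mk (Ideal.span {g})))) g}) :=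
    hilbertFun_eq_of_ringEquiv e'
  -- the one functional equation, and joint injectivity
  have key : hypersurfaceHFe e₁ μ₁ = hypersurfaceHFe (t + 1 + r) μ₂ := by
    rw [← h1, hB, hilbertSamuelFun, hH₂, h2, iterPSum_hypersurfaceHFe_succ]
  obtain ⟨-, hμ⟩ := hypersurfaceHFe_injective2 he₁1 (by omega) (le_trans hm hmμ₁) hμ₂1 key
  exact Ideal.pow_le_pow_right (hμ ▸ hmμ₁) hμ₂

end Bennett

/-! ## §3 The valuation-free certificate of a local point blow-up inside a field, and its reading along a valuation -/

section Cert

variable {K : Type} [Field K]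

/-- The chart subring `B[𝔪_B/c_j] ⊆ K` generated by `B` and the ratios `c_l/c_j`.  DEFINITION (support). -/
def chartClosure (B : Subring K) {r : ℕ} (c : Fin r → B) (j : Fin r) : Subring K :=
  Subring.closure ((B : Set K) ∪ (fun y : B => (y : K) / (c j : K)) '' Set.range c)

/-- **Valuation-free certificate** that `B' ⊆ K` is the blowing up of the closed point of the local subring `B ⊆ K` in the
chart of a generator: `M = (c)` (`M` will be `𝔪_B`), `c_j ≠ 0`, `B[𝔪_B/c_j] ⊆ B'`, and every element of `B'` is a quotient `y/z` of elements of
`B[𝔪_B/c_j]` whose denominator is a unit of `B'`.  (The valuation ring of the CP currency `IsLocalBlowupAlong` only enters through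
`isLocalBlowupAlong_of_cert`.)  DEFINITION (support). [cite: NovacoskiSpivakovsky2014, Def. 2.11] -/
structure PointBlowupCert (B B' : Subring K) (M : Ideal B) : Type where
  /-- number of generators -/
  r : ℕ
  /-- the generators `c` of `M` -/
  c : Fin r → B
  /-- the chart index -/
  j : Fin r
  /-- `M = (c)` -/
  span_eq : Ideal.span (Set.range c) = M
  /-- `c_j ≠ 0` -/
  ne_zero : c j ≠ 0
  /-- `B[M/c_j] ⊆ B'` -/
  le : chartClosure B c j ≤ B'
  /-- `B'` is a ring of fractions of `B[M/c_j]` with denominators invertible in `B'` -/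
  frac : ∀ w ∈ B', ∃ y ∈ chartClosure B c j, ∃ z ∈ chartClosure B c j, z ≠ 0 ∧ z⁻¹ ∈ B' ∧ w = y / z

/-- **Reading the certificate along a valuation**: if `O` is a valuation ring of `K` DOMINATING the local ring `B'`, then a
certified point blow-up `B ⊆ B'` is the local blowing up of `B` along `𝔪_B` with respect to `O` in the tree currency
`IsLocalBlowupAlong` (the denominators of `B'` have value `0`; the ratios `c_l/c_j ∈ B' ⊆ O` give `c_j` maximal value).
[cite: NovacoskiSpivakovsky2014, Def. 2.11] [cite: CossartPiltant2019, §2.2] -/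
theorem isLocalBlowupAlong_of_cert {B B' : Subring K} {M : Ideal B} [IsLocalRing B'] (hc : PointBlowupCert B B' M)
    {O : ValuationSubring K} (hB'O : SubringDominates B' O.toSubring) :
    IsLocalBlowupAlong O B M B' := by
  obtain ⟨r, c, j, hspan, hcj, hCB', hsurj⟩ := hc
  have hB'le : B' ≤ O.toSubring := hB'O.1
  have hBB' : B ≤ B' := le_trans (fun x hx => Subring.subset_closure (Or.inl hx)) hCB'
  have hBO : B ≤ O.toSubring := hBB'.trans hB'le
  have hcj' : ((c j : B) : K) ≠ 0 := fun h => hcj (Subtype.ext h)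
  -- `c_j` has maximal value: `c_l/c_j ∈ B' ⊆ O`
  have hmax : ∀ l, O.valuation ((c l : B) : K) ≤ O.valuation ((c j : B) : K) := by
    intro l
    have hmem : ((c l : B) : K) / (c j : K) ∈ O :=
      hB'le (hCB' (Subring.subset_closure (Or.inr ⟨c l, ⟨l, rfl⟩, rfl⟩)))
    have hle : O.valuation (((c l : B) : K) / (c j : K)) ≤ 1 := (O.valuation_le_one_iff _).mpr hmem
    have heq : ((c l : B) : K) = ((c l : B) : K) / (c j : K) * (c j : K) := by rw [div_mul_cancel₀ _ hcj']
    calc O.valuation ((c l : B) : K) = O.valuation (((c l : B) : K) / (c j : K)) * O.valuation ((c j : B) : K) := by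
          conv_lhs => rw [heq]
          rw [map_mul]
      _ ≤ 1 * O.valuation ((c j : B) : K) := mul_le_mul' hle le_rfl
      _ = O.valuation ((c j : B) : K) := one_mul _
  have h := isLocalBlowupAlong_of_generators (P := M) hBO c hspan j hcj hmax
  -- the target of `h` is `B'`
  have hB' : B' = locAtCentre (chartClosure B c j) O := by
    apply le_antisymm
    · intro w hw
      obtain ⟨y, hy, z, hz, hz0, hzinv, rfl⟩ := hsurj w hw
      refine ⟨y, hy, z, hz, ?_, rfl⟩
      have hz1 : O.valuation z ≤ 1 := (O.valuation_le_one_iff _).mpr (hB'le (hCB' hz))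
      have hzi1 : O.valuation z⁻¹ ≤ 1 := (O.valuation_le_one_iff _).mpr (hB'le hzinv)
      have h1 : O.valuation z * O.valuation z⁻¹ = 1 := by rw [← map_mul, mul_inv_cancel₀ hz0, map_one]
      refine le_antisymm hz1 ?_
      calc (1 : O.ValueGroup) = O.valuation z * O.valuation z⁻¹ := h1.symm
        _ ≤ O.valuation z * 1 := mul_le_mul' le_rfl hzi1
        _ = O.valuation z := mul_one _
    · rintro _ ⟨y, hy, z, hz, hvz, rfl⟩
      have hyB' : y ∈ B' := hCB' hy
      have hzB' : z ∈ B' := hCB' hz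
      have hzu : (⟨z, hzB'⟩ : B') ∉ maximalIdeal B' := by
        rw [(subringDominates_valuationSubring_iff hB'le).mp hB'O ⟨z, hzB'⟩]
        change ¬ O.valuation z < 1
        rw [hvz]
        exact lt_irrefl 1
      have hunit : IsUnit (⟨z, hzB'⟩ : B') := by
        by_contra hnu
        exact hzu ((IsLocalRing.mem_maximalIdeal _).mpr hnu)
      obtain ⟨-, hzinv⟩ := (isUnit_subring_iff_inv_mem _).mp hunit
      rw [div_eq_mul_inv]
      exact B'.mul_mem hyB' hzinv
  rw [hB']
  exact h

end Cert

/-! ## §4 The image of a local ring in a field: a local subring; domination along local homomorphisms -/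

section RangeLocal

variable {A : Type u} [CommRing A] {L : Type} [Field L]

/-- The image `φ(A) ⊆ L` of a local ring is a local ring (a quotient of `A`). [folklore] -/
theorem isLocalRing_range [IsLocalRing A] {L' : Type} [CommRing L'] [Nontrivial L'] (φ : A →+* L') :
    IsLocalRing φ.range :=
  IsLocalRing.of_surjective' φ.rangeRestrict φ.rangeRestrict_surjective

/-- `φ(a)` is a unit of `φ(A)` iff `a` is a unit (`ker φ ⊆ 𝔪_A`). [folklore] -/
theorem isUnit_rangeRestrict_iff [IsLocalRing A] (φ : A →+* L) (a : A) : IsUnit (φ.rangeRestrict a) ↔ IsUnit a := by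
  refine ⟨fun h => ?_, fun h => h.map _⟩
  obtain ⟨w, hw⟩ := h
  obtain ⟨b, hb⟩ := φ.rangeRestrict_surjective (↑w⁻¹ : φ.range)
  have h1 : φ.rangeRestrict (a * b) = 1 := by rw [map_mul, hb, ← hw, Units.mul_inv]
  have h2 : a * b - 1 ∈ maximalIdeal A := by
    refine IsLocalRing.le_maximalIdeal (RingHom.ker_ne_top φ.rangeRestrict) ?_
    rw [RingHom.mem_ker, map_sub, h1, map_one, sub_self]
  by_contra ha
  have hab : a * b ∈ maximalIdeal A :=
    Ideal.mul_mem_right _ _ ((IsLocalRing.mem_maximalIdeal _).mpr ha)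
  have h1A : (1 : A) ∈ maximalIdeal A := by
    have := Ideal.sub_mem _ hab h2
    rwa [sub_sub_cancel] at this
  exact (IsLocalRing.maximalIdeal.isMaximal A).ne_top (Ideal.eq_top_of_isUnit_mem _ h1A isUnit_one)

/-- `φ(a) ∈ 𝔪_{φ(A)} ↔ a ∈ 𝔪_A`. [folklore] -/
theorem mem_maximalIdeal_range_iff [IsLocalRing A] (φ : A →+* L) (a : A) :
    (haveI := isLocalRing_range φ; φ.rangeRestrict a ∈ maximalIdeal φ.range) ↔ a ∈ maximalIdeal A := by
  haveI := isLocalRing_range φ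
  rw [IsLocalRing.mem_maximalIdeal, IsLocalRing.mem_maximalIdeal, mem_nonunits_iff, mem_nonunits_iff,
    isUnit_rangeRestrict_iff]

/-- `𝔪_A · φ(A) = 𝔪_{φ(A)}`. [folklore] -/
theorem map_rangeRestrict_maximalIdeal [IsLocalRing A] (φ : A →+* L) :
    (haveI := isLocalRing_range φ; (maximalIdeal A).map φ.rangeRestrict = maximalIdeal φ.range) := by
  haveI := isLocalRing_range φ
  apply le_antisymm
  · exact Ideal.map_le_iff_le_comap.mpr fun a ha => (mem_maximalIdeal_range_iff φ a).mpr ha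
  · intro b hb
    obtain ⟨a, rfl⟩ := φ.rangeRestrict_surjective b
    exact Ideal.mem_map_of_mem _ ((mem_maximalIdeal_range_iff φ a).mp hb)

/-- **Domination along a local homomorphism**: if `σ : A → A'` is a local homomorphism of local rings and
`φ' ∘ σ = φ`, then `φ'(A')` dominates `φ(A)` inside `L`. [cite: NovacoskiSpivakovsky2014, Def. 2.11] -/
theorem subringDominates_range {A' : Type u} [CommRing A'] [IsLocalRing A'] (σ : A →+* A') [IsLocalHom σ]
    (φ : A →+* L) (φ' : A' →+* L) (h : ∀ a, φ' (σ a) = φ a) : SubringDominates φ.range φ'.range := by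
  refine ⟨?_, ?_⟩
  · rintro _ ⟨a, rfl⟩
    exact ⟨σ a, h a⟩
  · rintro _ ⟨a, rfl⟩ hinv
    by_cases ha : IsUnit a
    · obtain ⟨w, rfl⟩ := ha
      exact ⟨↑w⁻¹, map_units_inv φ w⟩
    · have hφa : φ a = 0 := by
        by_contra hne
        obtain ⟨a'', ha''⟩ := hinv
        have hσa : ¬ IsUnit (σ a) := fun hu => ha (IsLocalHom.map_nonunit a hu)
        apply hσa
        rw [← isUnit_rangeRestrict_iff φ']
        refine ⟨⟨φ'.rangeRestrict (σ a), φ'.rangeRestrict a'', Subtype.ext ?_, Subtype.ext ?_⟩, rfl⟩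
        · change φ' (σ a) * φ' a'' = 1
          rw [h, ha'', mul_inv_cancel₀ hne]
        · change φ' a'' * φ' (σ a) = 1
          rw [h, ha'', inv_mul_cancel₀ hne]
      rw [hφa, inv_zero]
      exact φ.range.zero_mem

end RangeLocal

end Summit.ResolutionOfSingularities.ResolutionOfSingularities.Theorems.ShallowPort
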